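import Mathlib
import Summits.Ventures.PercRepro2.TypedParallel
import Summits.Ventures.PercRepro2.TypedClosed
import Summits.Ventures.PercRepro2.ThreeTypedAll
import Summits.Ventures.PercRepro2.ContractDefs

/-!
# Typed-base reductions VI: contraction and the minor-closed reducible class (blind cell
PercRepro2, night-3 g2, 2026-08-24; kernel-checked)

* **`typedCount_contract_open`**: the typed count on `H` with an edge `g = {u, v}` PINNED OPEN is
  the typed count on `H/{u, v}` (`Contract.contractEnds`, the cell's contraction on the same
  vertex and edge types) with the marks mapped by `contractMap` — from `conn_contract_open_iff`
  (with `g` open, `a ↔_H b` iff the images are connected in `H/{u, v}`; the closure lemma on the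
  `H`-cluster of `a`) and `st_contract_open`;
* **`RedM`** — the typed instances `(ends, marks, F, z, τ)` that reduce to at most three typed
  edges by contracting pinned-open edges, dropping typed loops, a typed root pair (count `0`), and by the rules (a) series,
  (b) parallel, (c) unmarked leaf, (d) pendant `b` / `o` in their open-graph forms: exactly the rules of
  `LEAD-TYPED-REDUCTION.md` §1–§2 applied to the minor `H[z]` (pinned-open edges contracted,
  pinned-closed edges deleted) with every edge of `F` typed;
* **`typedCount_nonneg_of_redM`**: row 2′TRI (`0 ≤ typedCount F z τ K₃`, mixed types) on every
  instance of `RedM` — the formal content of «a minimal counterexample to 2′TRI is an all-mixed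
  reduced skeleton» in the direction the census uses, with the base `|F| ≤ 3` of `ThreeTypedAll`.
  Not claimed: anything on the reduced class itself;
* **`Gc_nonneg_of_redM`**, **`ZDelta_of_redM`**: the weighted form — (HCOV) and the crux of record
  (ZΔ) for every weight vector all of whose typed instances supported on the fractional edge set
  are in `RedM` (via `triSum_nonneg_of_typedCount_subset`);
  Inhabitants with arbitrarily many typed edges: `TypedExamples.lean`.
-/

namespace Summit.Ventures.PercRepro2

namespace CovForm

namespace TypedRed

open OneTyped

/-! ## Contracting a pinned-open edge -/

section ContractEdge

open Contract

variable {V : Type*} {E : Type*} [DecidableEq V] [DecidableEq E]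

omit [DecidableEq E] in
/-- With `g = {u, v}` open, every vertex is connected to its image under the contraction of `{u, v}`. -/
lemma conn_contractMap_self {ends : E → Sym2 V} {ω : Config E} {g : E} {u v : V}
    (hg : ends g = s(u, v)) (hω : ω g = true) (p : V) :
    Conn ends ω p (contractMap {u, v} u p) := by
  by_cases hp : p ∈ ({u, v} : Finset V)
  · rw [contractMap_of_mem hp]
    rw [Finset.mem_insert, Finset.mem_singleton] at hp
    rcases hp with rfl | rfl
    · exact conn_refl _ _ _
    · exact conn_symm (conn_of_openAdj ⟨g, hω, hg⟩)
  · rw [contractMap_of_notMem hp]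
    exact conn_refl _ _ _

omit [DecidableEq E] in
/-- **Contracting an open edge**: with `g = {u, v}` open, `a ↔ b` in `H` iff the images of `a, b`
are connected in `H/{u, v}`. -/
lemma conn_contract_open_iff {ends : E → Sym2 V} {ω : Config E} {g : E} {u v : V}
    (hg : ends g = s(u, v)) (hω : ω g = true) (a b : V) :
    Conn ends ω a b ↔
      Conn (contractEnds ends {u, v} u) ω (contractMap {u, v} u a) (contractMap {u, v} u b) := by
  constructor
  · exact conn_contract_of_conn
  · intro h
    let S : Set V := {y | Conn ends ω a y}
    have hS : ∀ y ∈ S, ∀ y', (openGraph (contractEnds ends {u, v} u) ω).Adj y y' → y' ∈ S := by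
      intro y hy y' hyy'
      obtain ⟨_, e', he', hends⟩ := openGraph_adj.1 hyy'
      obtain ⟨⟨p, q⟩, hpq⟩ := Quot.exists_rep (ends e')
      have hpq' : ends e' = s(p, q) := hpq.symm
      rw [contractEnds_apply, hpq', Sym2.map_mk, Sym2.eq_iff] at hends
      have hpq'' : Conn ends ω p q := conn_of_openAdj ⟨e', he', hpq'⟩
      have hp := conn_contractMap_self hg hω p
      have hq := conn_contractMap_self hg hω q
      rcases hends with ⟨h1, h2⟩ | ⟨h1, h2⟩
      · -- `y = π p`, `y' = π q`
        show Conn ends ω a y'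
        rw [← h2]
        rw [← h1] at hy
        exact conn_trans (conn_trans (conn_trans hy (conn_symm hp)) hpq'') hq
      · -- `y = π q`, `y' = π p`
        show Conn ends ω a y'
        rw [← h1]
        rw [← h2] at hy
        exact conn_trans (conn_trans (conn_trans hy (conn_symm hq)) (conn_symm hpq'')) hp
    have hmem : contractMap {u, v} u b ∈ S :=
      mem_of_conn_of_closed hS (conn_contractMap_self hg hω a) h
    exact conn_trans hmem (conn_symm (conn_contractMap_self hg hω b))

variable (ends : E → Sym2 V) (o a₁ a₂ a₃ b : V)

omit [DecidableEq E] in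
/-- The state of a configuration with `g = {u, v}` open is the state in `H/{u, v}` with the marks
mapped. -/
lemma st_contract_open {g : E} {u v : V} (hg : ends g = s(u, v)) {ω : Config E} (hω : ω g = true) :
    st ends o a₁ a₂ a₃ b ω =
      st (contractEnds ends {u, v} u) (contractMap {u, v} u o) (contractMap {u, v} u a₁)
        (contractMap {u, v} u a₂) (contractMap {u, v} u a₃) (contractMap {u, v} u b) ω := by
  have key := conn_contract_open_iff hg hω
  unfold st
  simp only [Prod.mk.injEq]
  exact ⟨decide_eq_decide.mpr (key _ _), decide_eq_decide.mpr (key _ _),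
    decide_eq_decide.mpr (key _ _), decide_eq_decide.mpr (key _ _),
    decide_eq_decide.mpr (key _ _), decide_eq_decide.mpr (key _ _),
    decide_eq_decide.mpr (key _ _)⟩

variable [Fintype E] {R : Type*} [Field R]

/-- **Contracting a pinned-open edge**: the typed count on `H` with `g = {u, v}` pinned open is the
typed count on `H/{u, v}` with the marks mapped. -/
theorem typedCount_contract_open {g : E} {u v : V} (hg : ends g = s(u, v)) (F : Finset E)
    (hgF : g ∉ F) (z : Config E) (hz : z g = true) (τ : E → ℕ) :
    typedCount F z τ (K3 ends o a₁ a₂ a₃ b : Config E → Config E → Config E → R) =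
      typedCount F z τ (K3 (contractEnds ends {u, v} u) (contractMap {u, v} u o)
        (contractMap {u, v} u a₁) (contractMap {u, v} u a₂) (contractMap {u, v} u a₃)
        (contractMap {u, v} u b)) := by
  refine typedCount_congr_K_on _ _ _ fun x y w hxyw _ => ?_
  obtain ⟨hx, hy, hw⟩ := hxyw g hgF
  rw [K3_eq_KB, K3_eq_KB, st_contract_open ends o a₁ a₂ a₃ b hg (hx.trans hz),
    st_contract_open ends o a₁ a₂ a₃ b hg (hy.trans hz),
    st_contract_open ends o a₁ a₂ a₃ b hg (hw.trans hz)]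

end ContractEdge

/-! ## The minor-closed reducible class -/

section RedM

open Contract

variable {V : Type*} {E : Type*} [DecidableEq V] [Fintype E] [DecidableEq E]

/-- **The reducible typed instances, minor-closed**: the graph, the marks and the instance
`(F, z, τ)` reduce to at most three typed edges by contracting pinned-open edges (`contract`,
`typedCount_contract_open`), dropping typed loops (`loop`, `typedCount_loop`), a typed root pair
(`rootPair`, `typedCount_root_pair`: the count is `0`) and the rules
(a) series, (b) parallel, (c) unmarked leaf, (d) pendant `b` / `o` in their open-graph forms — i.e. the rules of `LEAD-TYPED-REDUCTION.md` §1 applied to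
the MINOR `H[z]` (pinned-open edges contracted, pinned-closed edges deleted) with every edge of `F`
typed. -/
inductive RedM : (E → Sym2 V) → V → V → V → V → V → Finset E → Config E → (E → ℕ) → Prop
  | base (ends : E → Sym2 V) (o a₁ a₂ a₃ b : V) (F : Finset E) (z : Config E) (τ : E → ℕ)
      (hF : F.card ≤ 3) : RedM ends o a₁ a₂ a₃ b F z τ
  | contract (ends : E → Sym2 V) (o a₁ a₂ a₃ b : V) (F : Finset E) (z : Config E) (τ : E → ℕ)
      {g : E} {u v : V} (hg : ends g = s(u, v)) (hgF : g ∉ F) (hz : z g = true)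
      (h : RedM (contractEnds ends {u, v} u) (contractMap {u, v} u o) (contractMap {u, v} u a₁)
        (contractMap {u, v} u a₂) (contractMap {u, v} u a₃) (contractMap {u, v} u b) F z τ) :
      RedM ends o a₁ a₂ a₃ b F z τ
  | rootPair (ends : E → Sym2 V) (o a₁ a₂ a₃ b : V) (F : Finset E) (z : Config E) (τ : E → ℕ)
      {f : E} (hf : ends f = s(a₁, a₂)) (hfF : f ∈ F) : RedM ends o a₁ a₂ a₃ b F z τ
  | loop (ends : E → Sym2 V) (o a₁ a₂ a₃ b : V) (F : Finset E) (z : Config E) (τ : E → ℕ)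
      {f : E} {u : V} (hf : ends f = s(u, u)) (hfF : f ∈ F)
      (h : RedM ends o a₁ a₂ a₃ b (F.erase f) (Function.update z f false) τ) :
      RedM ends o a₁ a₂ a₃ b F z τ
  | leaf (ends : E → Sym2 V) (o a₁ a₂ a₃ b : V) (F : Finset E) (z : Config E) (τ : E → ℕ)
      {f : E} {l u : V} (hf : ends f = s(l, u)) (hlu : l ≠ u) (hlo : l ≠ o) (hl1 : l ≠ a₁)
      (hl2 : l ≠ a₂) (hl3 : l ≠ a₃) (hlb : l ≠ b) (hfF : f ∈ F)
      (hcl : ∀ e', e' ≠ f → l ∈ ends e' → e' ∉ F ∧ z e' = false)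
      (h : RedM ends o a₁ a₂ a₃ b (F.erase f) (Function.update z f false) τ) :
      RedM ends o a₁ a₂ a₃ b F z τ
  | pendantB (ends : E → Sym2 V) (o a₁ a₂ a₃ b : V) (F : Finset E) (z : Config E) (τ : E → ℕ)
      {f : E} {u : V} (hf : ends f = s(b, u)) (hbu : b ≠ u) (hbo : b ≠ o) (hb1 : b ≠ a₁)
      (hb2 : b ≠ a₂) (hb3 : b ≠ a₃) (hfF : f ∈ F)
      (hcl : ∀ e', e' ≠ f → b ∈ ends e' → e' ∉ F ∧ z e' = false)
      (h : RedM ends o a₁ a₂ a₃ b (F.erase f) (Function.update z f true) τ) :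
      RedM ends o a₁ a₂ a₃ b F z τ
  | pendantO (ends : E → Sym2 V) (o a₁ a₂ a₃ b : V) (F : Finset E) (z : Config E) (τ : E → ℕ)
      {f : E} {u : V} (hf : ends f = s(o, u)) (hou : o ≠ u) (ho1 : o ≠ a₁) (ho2 : o ≠ a₂)
      (ho3 : o ≠ a₃) (hob : o ≠ b) (hfF : f ∈ F)
      (hcl : ∀ e', e' ≠ f → o ∈ ends e' → e' ∉ F ∧ z e' = false)
      (h : RedM ends o a₁ a₂ a₃ b (F.erase f) (Function.update z f true) τ) :
      RedM ends o a₁ a₂ a₃ b F z τ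
  | parallel (ends : E → Sym2 V) (o a₁ a₂ a₃ b : V) (F : Finset E) (z : Config E) (τ : E → ℕ)
      {e f : E} (hef : e ≠ f) (hpar : ends e = ends f) (heF : e ∈ F) (hfF : f ∈ F)
      (h1 : RedM ends o a₁ a₂ a₃ b (F.erase f) (Function.update z f false)
        (Function.update τ e 1))
      (h2 : RedM ends o a₁ a₂ a₃ b (F.erase f) (Function.update z f false)
        (Function.update τ e 2))
      (h3 : RedM ends o a₁ a₂ a₃ b ((F.erase f).erase e)
        (Function.update (Function.update z f false) e true) τ) :
      RedM ends o a₁ a₂ a₃ b F z τ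
  | series (ends : E → Sym2 V) (o a₁ a₂ a₃ b : V) (F : Finset E) (z : Config E) (τ : E → ℕ)
      {e f : E} (hef : e ≠ f) {u w v : V} (he : ends e = s(u, w)) (hf : ends f = s(w, v))
      (hwu : w ≠ u) (hwv : w ≠ v) (hwo : w ≠ o) (hw1 : w ≠ a₁) (hw2 : w ≠ a₂) (hw3 : w ≠ a₃)
      (hwb : w ≠ b) (heF : e ∈ F) (hfF : f ∈ F)
      (hcl : ∀ e', e' ≠ e → e' ≠ f → w ∈ ends e' → e' ∉ F ∧ z e' = false)
      (h0 : RedM ends o a₁ a₂ a₃ b ((F.erase f).erase e)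
        (Function.update (Function.update z f true) e false) τ)
      (h1 : RedM ends o a₁ a₂ a₃ b (F.erase f) (Function.update z f true)
        (Function.update τ e 1))
      (h2 : RedM ends o a₁ a₂ a₃ b (F.erase f) (Function.update z f true)
        (Function.update τ e 2)) :
      RedM ends o a₁ a₂ a₃ b F z τ

variable {R : Type*} [Field R] [LinearOrder R] [IsStrictOrderedRing R]

/-- **Row 2′TRI on the minor-closed reducible class** (kernel-checked): every typed count of `K₃`
with mixed types whose instance reduces — by contracting pinned-open edges and by the rules
(a)–(d) in the open graph — to at most three typed edges is nonnegative. -/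
theorem typedCount_nonneg_of_redM {ends : E → Sym2 V} {o a₁ a₂ a₃ b : V} {F : Finset E}
    {z : Config E} {τ : E → ℕ} (h : RedM ends o a₁ a₂ a₃ b F z τ)
    (hτ : ∀ e ∈ F, τ e = 1 ∨ τ e = 2) :
    0 ≤ typedCount F z τ (K3 ends o a₁ a₂ a₃ b : Config E → Config E → Config E → R) := by
  induction h with
  | base ends o a₁ a₂ a₃ b F z τ hF =>
    exact TwoTyped.typedCount_nonneg_of_card_le_three' ends o a₁ a₂ a₃ b F hF z τ hτ
  | @contract ends o a₁ a₂ a₃ b F z τ g u v hg hgF hz _ ih =>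
    rw [typedCount_contract_open ends o a₁ a₂ a₃ b hg F hgF z hz τ]
    exact ih hτ
  | @rootPair ends o a₁ a₂ a₃ b F z τ f hf hfF =>
    have h1 : 1 ≤ τ f := by rcases hτ f hfF with h | h <;> omega
    rw [typedCount_root_pair ends o a₁ a₂ a₃ b hf F hfF z τ h1]
  | @loop ends o a₁ a₂ a₃ b F z τ f u hf hfF _ ih =>
    rw [typedCount_loop ends o a₁ a₂ a₃ b hf F hfF z τ,
      typedCount_type_zero F _ hfF z _ (Function.update_self _ _ _),
      typedCount_congr_τ (F.erase _) _ (τ' := τ)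
        (fun e he => Function.update_of_ne (Finset.ne_of_mem_erase he) _ _)]
    exact mul_nonneg (Nat.cast_nonneg _) (ih fun e he => hτ e (Finset.mem_of_mem_erase he))
  | @leaf ends o a₁ a₂ a₃ b F z τ f l u hf hlu hlo hl1 hl2 hl3 hlb hfF hcl _ ih =>
    rw [typedCount_unmarked_leaf' ends o a₁ a₂ a₃ b hf hlu hlo hl1 hl2 hl3 hlb F hfF z τ hcl,
      typedCount_type_zero F _ hfF z _ (Function.update_self _ _ _),
      typedCount_congr_τ (F.erase _) _ (τ' := τ)
        (fun e he => Function.update_of_ne (Finset.ne_of_mem_erase he) _ _)]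
    exact mul_nonneg (Nat.cast_nonneg _) (ih fun e he => hτ e (Finset.mem_of_mem_erase he))
  | @pendantB ends o a₁ a₂ a₃ b F z τ f u hf hbu hbo hb1 hb2 hb3 hfF hcl _ ih =>
    have h1 : 1 ≤ τ f := by rcases hτ f hfF with h | h <;> omega
    rw [typedCount_pendant_b' ends o a₁ a₂ a₃ b hf hbu hbo hb1 hb2 hb3 F hfF z τ h1 hcl,
      typedCount_type_three F _ hfF z _ (Function.update_self _ _ _),
      typedCount_congr_τ (F.erase _) _ (τ' := τ)
        (fun e he => Function.update_of_ne (Finset.ne_of_mem_erase he) _ _)]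
    exact mul_nonneg (Nat.cast_nonneg _) (ih fun e he => hτ e (Finset.mem_of_mem_erase he))
  | @pendantO ends o a₁ a₂ a₃ b F z τ f u hf hou ho1 ho2 ho3 hob hfF hcl _ ih =>
    have h1 : 1 ≤ τ f := by rcases hτ f hfF with h | h <;> omega
    rw [typedCount_pendant_o' ends o a₁ a₂ a₃ b hf hou ho1 ho2 ho3 hob F hfF z τ h1 hcl,
      typedCount_type_three F _ hfF z _ (Function.update_self _ _ _),
      typedCount_congr_τ (F.erase _) _ (τ' := τ)
        (fun e he => Function.update_of_ne (Finset.ne_of_mem_erase he) _ _)]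
    exact mul_nonneg (Nat.cast_nonneg _) (ih fun e he => hτ e (Finset.mem_of_mem_erase he))
  | @parallel ends o a₁ a₂ a₃ b F z τ e f hef hpar heF hfF _ _ _ ih1 ih2 ih3 =>
    have heF' : e ∈ F.erase f := Finset.mem_erase.2 ⟨hef, heF⟩
    rw [typedCount_parallel ends o a₁ a₂ a₃ b hef hpar F heF hfF z τ (hτ e heF) (hτ f hfF),
      Finset.sum_range_succ, Finset.sum_range_succ, Finset.sum_range_succ, Finset.sum_range_succ,
      Finset.sum_range_zero, zero_add, muOr_zero _ _ (hτ e heF) (hτ f hfF), Nat.cast_zero, zero_mul,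
      zero_add]
    have hτ' : ∀ j, ∀ e' ∈ F.erase f, e' ≠ e →
        Function.update τ e j e' = 1 ∨ Function.update τ e j e' = 2 := by
      intro j e' he' hne
      rw [Function.update_of_ne hne]
      exact hτ e' (Finset.mem_of_mem_erase he')
    refine add_nonneg (add_nonneg (mul_nonneg (Nat.cast_nonneg _) ?_)
      (mul_nonneg (Nat.cast_nonneg _) ?_)) (mul_nonneg (Nat.cast_nonneg _) ?_)
    · refine ih1 fun e' he' => ?_
      by_cases hne : e' = e
      · subst hne; rw [Function.update_self]; exact Or.inl rfl
      · exact hτ' 1 e' he' hne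
    · refine ih2 fun e' he' => ?_
      by_cases hne : e' = e
      · subst hne; rw [Function.update_self]; exact Or.inr rfl
      · exact hτ' 2 e' he' hne
    · rw [typedCount_type_three (F.erase f) e heF' _ _ (Function.update_self _ _ _),
        typedCount_congr_τ ((F.erase f).erase e) _ (τ' := τ)
          (fun e' he' => Function.update_of_ne (Finset.ne_of_mem_erase he') _ _)]
      exact ih3 fun e' he' => hτ e' (Finset.mem_of_mem_erase (Finset.mem_of_mem_erase he'))
  | @series ends o a₁ a₂ a₃ b F z τ e f hef u w v he hf hwu hwv hwo hw1 hw2 hw3 hwb heF hfF hcl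
      _ _ _ ih0 ih1 ih2 =>
    have heF' : e ∈ F.erase f := Finset.mem_erase.2 ⟨hef, heF⟩
    rw [typedCount_series ends o a₁ a₂ a₃ b hef he hf hwu hwv hwo hw1 hw2 hw3 hwb F heF hfF z τ
        (hτ e heF) (hτ f hfF) hcl,
      Finset.sum_range_succ, Finset.sum_range_succ, Finset.sum_range_succ, Finset.sum_range_succ,
      Finset.sum_range_zero, zero_add, muAnd_three _ _ (hτ e heF) (hτ f hfF), Nat.cast_zero,
      zero_mul, add_zero]
    have hτ' : ∀ j, ∀ e' ∈ F.erase f, e' ≠ e →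
        Function.update τ e j e' = 1 ∨ Function.update τ e j e' = 2 := by
      intro j e' he' hne
      rw [Function.update_of_ne hne]
      exact hτ e' (Finset.mem_of_mem_erase he')
    refine add_nonneg (add_nonneg (mul_nonneg (Nat.cast_nonneg _) ?_)
      (mul_nonneg (Nat.cast_nonneg _) ?_)) (mul_nonneg (Nat.cast_nonneg _) ?_)
    · rw [typedCount_type_zero (F.erase f) e heF' _ _ (Function.update_self _ _ _),
        typedCount_congr_τ ((F.erase f).erase e) _ (τ' := τ)
          (fun e' he' => Function.update_of_ne (Finset.ne_of_mem_erase he') _ _)]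
      exact ih0 fun e' he' => hτ e' (Finset.mem_of_mem_erase (Finset.mem_of_mem_erase he'))
    · refine ih1 fun e' he' => ?_
      by_cases hne : e' = e
      · subst hne; rw [Function.update_self]; exact Or.inl rfl
      · exact hτ' 1 e' he' hne
    · refine ih2 fun e' he' => ?_
      by_cases hne : e' = e
      · subst hne; rw [Function.update_self]; exact Or.inr rfl
      · exact hτ' 2 e' he' hne

end RedM

/-! ## The weighted corollary -/

section Weighted

open Contract

variable {V : Type*} {E : Type*} [DecidableEq V] [Fintype E] [DecidableEq E] {R : Type*} [Field R]
  [LinearOrder R] [IsStrictOrderedRing R]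

/-- **(HCOV) on weight vectors whose fractional edges reduce**: if every typed instance supported
on the fractional edge set of `p` is in `RedM`, then `0 ≤ Gc p` (the cleared covariance form
`D · P(Q) · G` of row 2′HCOV). -/
theorem Gc_nonneg_of_redM (ends : E → Sym2 V) (o a₁ a₂ a₃ b : V) (p : E → R) (hp : IsProbVec p)
    (hred : ∀ G : Finset E, G ⊆ (Finset.univ.filter fun e => p e ≠ 0 ∧ p e ≠ 1) →
      ∀ (z : Config E) (σ : E → ℕ), (∀ e ∈ G, σ e = 1 ∨ σ e = 2) →
        RedM ends o a₁ a₂ a₃ b G z σ) :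
    0 ≤ Gc p ends o a₁ a₂ a₃ b := by
  rw [hcov_cubic p ends o a₁ a₂ a₃ b (fun _ => 0)]
  refine TwoTyped.triSum_nonneg_of_typedCount_subset (K3 ends o a₁ a₂ a₃ b)
    (Finset.univ.filter fun e => p e ≠ 0 ∧ p e ≠ 1) ?_ p (fun e => ⟨hp.nonneg e, hp.le_one e⟩) ?_ ∅
    (Finset.empty_subset _) (fun _ => 0) (fun e he => absurd he (Finset.notMem_empty e))
  · intro G hG z σ hσ
    exact typedCount_nonneg_of_redM (hred G hG z σ hσ) hσ
  · intro e he
    simp only [Finset.mem_filter, Finset.mem_univ, true_and, not_and, not_not] at he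
    by_cases h : p e = 0
    · exact Or.inl h
    · exact Or.inr (he h)

/-- **The crux of record (ZΔ) on weight vectors whose fractional edges reduce** (`ZDelta_of_HCov`). -/
theorem ZDelta_of_redM [Fintype V] (ends : E → Sym2 V) (o a₁ a₂ a₃ b : V) (p : E → R)
    (hp : IsProbVec p)
    (hred : ∀ G : Finset E, G ⊆ (Finset.univ.filter fun e => p e ≠ 0 ∧ p e ≠ 1) →
      ∀ (z : Config E) (σ : E → ℕ), (∀ e ∈ G, σ e = 1 ∨ σ e = 2) →
        RedM ends o a₁ a₂ a₃ b G z σ)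
    (hord : prob p (connEvent ends a₁ b) ≤ prob p (connEvent ends a₂ b)) :
    ZDelta p ends o a₁ a₂ a₃ b :=
  ZDelta_of_HCov p hp ends hord (Gc_nonneg_of_redM ends o a₁ a₂ a₃ b p hp hred)

end Weighted

end TypedRed

end CovForm

end Summit.Ventures.PercRepro2
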